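import Summits.AtomisticToContinuum.Crystallization.Theorems.HullExactificationCascadeRobustBarlowTemplateTransportSteps1
import Summits.AtomisticToContinuum.Crystallization.Theorems.HullExactificationCascadeRobustBarlowTemplateTransportSteps2
import Summits.AtomisticToContinuum.Crystallization.Theorems.HullExactificationCascadeRobustBarlowTemplateTransportSteps7
import Summits.AtomisticToContinuum.Crystallization.Theorems.HullExactificationCascadeRobustBarlowTemplateTransportAttach1
import Summits.AtomisticToContinuum.Crystallization.Theorems.PalmUnimodularRigidityShellsToBarlowChartTransportComm1

/-!
# Line `registered` (crux `RobustBarlowTemplate`, stmt-AtomisticToContinuum-12088): commutation of `V` with `I` and `J` (part 1/3)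

Helper lemmas for `develop_transport` (the geometric half of the development): frames
`⟨x, t₁, t₂, U⟩` read in the scale-relative integer charts `IsZChart` of an everywhere-good
configuration, their transports and the coherence of the resulting development `frameAt`.  The
only metric inputs are the chart transfer lemma `develop_transfer` and `bond_nb_iff`; everything
else is label combinatorics in `ℤ³` (pattern facts `TransportPatterns*` of the sibling crux 9227,
imported verbatim).  All `[folklore]` (HalesDSP2012 §1.3 for the two kissing patterns).

PORT of `PalmUnimodularRigidityShellsToBarlowChartTransportComm1.lean` of the closed sibling crux
`ShellsToBarlowChart` (stmt-9227) to the SCALE-RELATIVE shell relation `y ∈ shell S x` of this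
crux (in place of the bond window `0 < dist x y ∧ dist x y ≤ 28/25`) and to the five-argument
charts `IsZChart S x P A nbr`; the port rules (conjunct paths, `bond a b ↦ b ∈ shell S a`, the
threaded symmetry hypothesis `hsy : ∀ x ∈ S, ∀ y ∈ shell S x, x ∈ shell S y` replacing
`bond_symm`, `zchart_transfer` / `zchart_sqNormInt_eq` replacing `sqNormInt_transfer` /
`IsZChart.sqNormInt_eq`, the `open … hiding …` line) are listed under "Port notes" in
`…RobustBarlowTemplateTransportSteps1.lean` (and its extensions in `…TransportSteps6.lean`,
`…TransportAttach1.lean`).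

## Port notes (this part: `TransportComm1`)
* the two CHART-AGNOSTIC lemmas of the source part, `hregI_of_valid` and `hregJ_of_valid` (pure
  `OpsDefs` statements, no chart hypothesis), are NOT re-proved (the gate forbids restating landed
  declarations): they are used from the source module `…ShellsToBarlowChartTransportComm1`,
  imported for that purpose; only the two chart-dependent lemmas `Vstep_Istep_pt`,
  `Vstep_Istep_back` are ported, with `hsy` inserted right after `hch` (passed on to `Istep_spec`,
  `Vstep_spec`, `attach_I_even`, `attach_I_odd`, `transfer_nb_nb`, `transfer_nb_centre`); the bond
  conjunct in the conclusion of `Vstep_Istep_pt` became the shell membership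
  `(Vstep Pc nb (Istep Pc nb ⟨x, t₁, t₂, U⟩)).pt ∈ shell S (Vstep Pc nb ⟨x, t₁, t₂, U⟩).pt` (same
  position), the bonds inside the proofs became shell memberships and each `bond_symm h` an appeal
  `hsy a ha b h`; otherwise the proofs are the source proofs verbatim (no metric constant occurs in
  this part);
* imports: our parts 1, 2, 7, `Attach1` (as in the source) and the 9227 `Comm1`; since the latter
  makes the 9227 parts 1–7, `Lower`, `Vinv`, `Attach1`, `Comm1` visible, the `open … hiding …`
  line of our `…TransportAttach1` is EXTENDED by the two 9227 names redeclared here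
  (`Vstep_Istep_pt`, `Vstep_Istep_back`) — copy this longer line into later parts;
* the anchor at the end (explicit-`∀` form, registered sub-goal) is new.
-/

noncomputable section

namespace Summit.AtomisticToContinuum.Crystallization.Theorems.HullExactificationCascadeRobustBarlowTemplate

open Literature.Geometry.DiscreteGeometry Literature.MathematicalPhysics.StatisticalMechanics
open Summit.AtomisticToContinuum.Crystallization.Theorems.PalmUnimodularRigidityShellsToBarlowChart hiding
  IsZChart TransportSystem scales_tied sqNormInt_transfer bond_symm nb_mem zlab_spec zlab_nb bond_nb_iff
  pattern_cases transfer_nb_nb transfer_nb_centre transfer_nb_target sqNormInt_zlab_centre hcp_of_mirror_pair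
  Istep_spec Jstep_spec IinvStep_spec JinvStep_spec capWithAny_of_mem_cap IinvStep_Istep Istep_IinvStep
  JinvStep_Jstep Jstep_JinvStep polar_at_apex onesided_at_apex nb_inj Istep_lower Jstep_lower
  IinvStep_lower JinvStep_lower Vstep_spec polar_at_lower_apex onesided_at_lower_apex VinvStep_spec
  attach_I_even attach_I_odd Vstep_Istep_pt Vstep_Istep_back

variable {S : Set (EuclideanSpace ℝ (Fin 3))} {Pc : (EuclideanSpace ℝ (Fin 3)) → Finset (Fin 3 → ℤ)}
  {Ac : (EuclideanSpace ℝ (Fin 3)) → ((EuclideanSpace ℝ (Fin 3)) →ₗᵢ[ℝ] (EuclideanSpace ℝ (Fin 3)))}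
  {nb : (EuclideanSpace ℝ (Fin 3)) → (Fin 3 → ℤ) → (EuclideanSpace ℝ (Fin 3))}

/-- **`V ∘ I = I ∘ V`, the point.**  For a valid frame `g` at `x` whose four in-layer transports
are valid, the apex site over `Ix` is the `t₁`-neighbour of the frame `V g` at the apex site `u`
over `x`, and its label at `u` is `(V g).t₁`: in the model both are the site `(k+1, i+1, j)`.
[folklore] -/
theorem Vstep_Istep_pt (hch : ∀ z ∈ S, IsZChart S z (Pc z) (Ac z) (nb z))
    (hsy : ∀ x ∈ S, ∀ y ∈ shell S x, x ∈ shell S y) {x : (EuclideanSpace ℝ (Fin 3))}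
    (hx : x ∈ S) {t₁ t₂ : Fin 3 → ℤ} {U : Finset (Fin 3 → ℤ)} (hU : IsFrame (Pc x) t₁ t₂ U)
    (hI : IsFrame (Pc (nb x t₁)) (Istep Pc nb ⟨x, t₁, t₂, U⟩).t₁ (Istep Pc nb ⟨x, t₁, t₂, U⟩).t₂
      (Istep Pc nb ⟨x, t₁, t₂, U⟩).U)
    (hJ : IsFrame (Pc (nb x t₂)) (Jstep Pc nb ⟨x, t₁, t₂, U⟩).t₁ (Jstep Pc nb ⟨x, t₁, t₂, U⟩).t₂
      (Jstep Pc nb ⟨x, t₁, t₂, U⟩).U)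
    (hIi : IsFrame (Pc (nb x (-t₁))) (IinvStep Pc nb ⟨x, t₁, t₂, U⟩).t₁
      (IinvStep Pc nb ⟨x, t₁, t₂, U⟩).t₂ (IinvStep Pc nb ⟨x, t₁, t₂, U⟩).U)
    (hJi : IsFrame (Pc (nb x (-t₂))) (JinvStep Pc nb ⟨x, t₁, t₂, U⟩).t₁
      (JinvStep Pc nb ⟨x, t₁, t₂, U⟩).t₂ (JinvStep Pc nb ⟨x, t₁, t₂, U⟩).U) :
    (Vstep Pc nb (Istep Pc nb ⟨x, t₁, t₂, U⟩)).pt =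
        nb (Vstep Pc nb ⟨x, t₁, t₂, U⟩).pt (Vstep Pc nb ⟨x, t₁, t₂, U⟩).t₁ ∧
      (Vstep Pc nb (Istep Pc nb ⟨x, t₁, t₂, U⟩)).pt ∈ shell S (Vstep Pc nb ⟨x, t₁, t₂, U⟩).pt ∧
      zlab Pc nb (Vstep Pc nb ⟨x, t₁, t₂, U⟩).pt (Vstep Pc nb (Istep Pc nb ⟨x, t₁, t₂, U⟩)).pt =
        (Vstep Pc nb ⟨x, t₁, t₂, U⟩).t₁ := by
  have hregI := hregI_of_valid (Pc := Pc) (nb := nb) hI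
  obtain ⟨hyS, hbxy, hwP, hwx, -, -, -, -, -, -, -, hframe, hparI, -⟩ := Istep_spec hch hsy hx hU hregI
  obtain ⟨hcU, huS, hbu, hξP, hξx, hframeV, -, hbr⟩ := Vstep_spec hch hsy hx hU hI hJ hIi hJi
  have hPx := pattern_cases hch hx
  have hPy := pattern_cases hch hyS
  have hPu := pattern_cases hch huS
  obtain ⟨h12, hhex, hUP, -, -⟩ := id hU
  have ht₁ : t₁ ∈ Pc x := hhex (mem_hexLabels_iff.2 (Or.inl rfl))
  have ht₂ : t₂ ∈ Pc x := hhex (mem_hexLabels_iff.2 (Or.inr (Or.inl rfl)))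
  have hnt₁ : -t₁ ∈ Pc x := hhex (mem_hexLabels_iff.2 (Or.inr (Or.inr (Or.inr (Or.inl rfl)))))
  -- abbreviations
  set c := apexOf t₁ t₂ U with hc_def
  set u := nb x c with hu_def
  set ξ := zlab Pc nb u x with hξ_def
  have hcP : c ∈ Pc x := hUP hcU
  -- the new point is `nb (Ix) c'`
  have hpt : (Vstep Pc nb (Istep Pc nb ⟨x, t₁, t₂, U⟩)).pt =
      nb (nb x t₁) (apexOf (Istep Pc nb ⟨x, t₁, t₂, U⟩).t₁ (Istep Pc nb ⟨x, t₁, t₂, U⟩).t₂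
        (Istep Pc nb ⟨x, t₁, t₂, U⟩).U) := rfl
  have hVpt : (Vstep Pc nb ⟨x, t₁, t₂, U⟩).pt = u := rfl
  rw [hpt, hVpt] at *
  -- the new t₁ and its norm
  set t₁' := (Vstep Pc nb ⟨x, t₁, t₂, U⟩).t₁ with ht₁'_def
  have ht₁'P : t₁' ∈ Pc u := hframeV.2.1 (mem_hexLabels_iff.2 (Or.inl rfl))
  have Dt₁' : sqNormInt t₁' = 18 := zchart_sqNormInt_eq (hch u huS) ht₁'P
  set a' := (Istep Pc nb ⟨x, t₁, t₂, U⟩).t₁ with ha'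
  set b' := (Istep Pc nb ⟨x, t₁, t₂, U⟩).t₂ with hb'
  set U' := (Istep Pc nb ⟨x, t₁, t₂, U⟩).U with hU'
  obtain ⟨h12', hhex', hUP', -, -⟩ := id hframe
  have ha'P : a' ∈ Pc (nb x t₁) := hhex' (mem_hexLabels_iff.2 (Or.inl rfl))
  have hb'P : b' ∈ Pc (nb x t₁) := hhex' (mem_hexLabels_iff.2 (Or.inr (Or.inl rfl)))
  set c' := apexOf a' b' U' with hc'_def
  rcases hbr with ⟨hpar, hL, hnI, -, hE⟩ | ⟨hpar, hL, hnI, -, hO⟩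
  · /- EVEN: `u ~ Ix`, the new point `u' = nb y c'` is attached to `u = nb y (c' − a')` -/
    obtain ⟨hatt, hμeq⟩ := attach_I_even hch hsy hx hU hpar hregI
    have hpar' : frameParity a' b' U' = 1 := hparI.trans hpar
    obtain ⟨hc'U, hc'P, hc'off, hc1', hc2', hE'⟩ := even_form_of_parity hPy hframe hpar'
    -- `η = ξ + t₁'` is the label of `Ix` at `u`
    have hηP : ξ + t₁' ∈ Pc u := by
      have : ξ + t₁' ∈ lowerCap (Pc u) t₁' (Vstep Pc nb ⟨x, t₁, t₂, U⟩).t₂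
          (Vstep Pc nb ⟨x, t₁, t₂, U⟩).U := by rw [hL]; simp
      exact (mem_lowerCap_iff.1 this).1
    have hη : zlab Pc nb u (nb x t₁) = ξ + t₁' := by rw [← hnI]; exact zlab_nb hch huS hηP
    -- bonds `u ~ Ix`, `u ~ u'`
    have hbuy : nb x t₁ ∈ shell S u := by
      rw [← hnI]; exact (nb_mem hch huS hηP).2
    have hμP : c' - a' ∈ Pc (nb x t₁) := hc1'
    have hbuu' : nb (nb x t₁) c' ∈ shell S u := by
      have := (bond_nb_iff hch hyS hμP hc'P).2 (by
        rw [show c' - a' - c' = -a' by abel, sqNormInt_neg]; exact zchart_sqNormInt_eq (hch _ hyS) ha'P)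
      rwa [hatt] at this
    have hu'S : nb (nb x t₁) c' ∈ S := (nb_mem hch hyS hc'P).1
    have hθ := zlab_spec hch huS hu'S hbuu'
    -- distances at `u`
    have Dθη : sqNormInt (zlab Pc nb u (nb (nb x t₁) c') - zlab Pc nb u (nb x t₁)) = 18 := by
      rw [transfer_nb_centre hch hsy hyS huS (hsy _ huS _ hbuy) hc'P hbuu']
      exact zchart_sqNormInt_eq (hch _ hyS) hc'P
    have Dθξ : sqNormInt (zlab Pc nb u (nb (nb x t₁) c') - ξ) = 54 := by
      have hbux : nb (nb x t₁) (zlab Pc nb (nb x t₁) x) ∈ shell S u := by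
        rw [hwx]; exact hsy _ hx _ hbu
      have htr := transfer_nb_nb hch hsy hyS huS (hsy _ huS _ hbuy) hc'P hwP hbuu' hbux
      rw [hwx] at htr
      rw [hξ_def, htr]
      have h54 := (dist_evenCap_c (Pc (nb x t₁)) hPy a' ha'P b' hb'P c' hc'P h12' hhex' hc'off
        hc1' hc2').2.2.2.1
      have e : -a' = zlab Pc nb (nb x t₁) x := by show -(-zlab Pc nb (nb x t₁) x) = _; rw [neg_neg]
      rwa [e] at h54
    have hθeq : zlab Pc nb u (nb (nb x t₁) c') = t₁' := by
      have h := label_third_vertex (Pc u) hPu ξ hξP (ξ + t₁') hηP _ hθ.1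
        (by rw [show ξ - (ξ + t₁') = -t₁' by abel, sqNormInt_neg]; exact Dt₁')
        (by rw [← hη]; exact Dθη) Dθξ (by rw [show ξ + t₁' - ξ = t₁' by abel]; exact ht₁'P)
      rw [h]; abel
    refine ⟨?_, hbuu', hθeq⟩
    rw [← hθeq]; exact hθ.2.symm
  · /- ODD: `u ~ x ~ u'`, the new point `u' = nb x (c + t₁)` -/
    obtain ⟨hatt, hμeq⟩ := attach_I_odd hch hsy hx hU hpar hregI
    obtain ⟨-, -, hcoff, hc1, hc2, hOform⟩ := odd_form_of_parity hPx hU hpar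
    have hdx := dist_oddCap (Pc x) hPx t₁ ht₁ t₂ ht₂ c hcP h12 hhex hcoff hc1 hc2
    -- `η⁻ = ξ − t₁'` is the label of `I⁻¹x` at `u`
    have hηP : ξ - t₁' ∈ Pc u := by
      have : ξ - t₁' ∈ lowerCap (Pc u) t₁' (Vstep Pc nb ⟨x, t₁, t₂, U⟩).t₂
          (Vstep Pc nb ⟨x, t₁, t₂, U⟩).U := by rw [hL]; simp
      exact (mem_lowerCap_iff.1 this).1
    have hη : zlab Pc nb u (nb x (-t₁)) = ξ - t₁' := by rw [← hnI]; exact zlab_nb hch huS hηP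
    -- bonds `u ~ I⁻¹x`, `u ~ u' = nb x (c + t₁)`
    have hbum : nb x (-t₁) ∈ shell S u :=
      (bond_nb_iff hch hx hcP hnt₁).2 (by rw [sqNormInt_sub_comm]; exact hdx.1)
    have hbuu' : nb x (c + t₁) ∈ shell S u :=
      (bond_nb_iff hch hx hcP hc1).2 hdx.2.2.2.2.2.2.2.2.2.2.1
    have hu'S : nb x (c + t₁) ∈ S := (nb_mem hch hx hc1).1
    have hθ := zlab_spec hch huS hu'S hbuu'
    have Dθξ : sqNormInt (zlab Pc nb u (nb x (c + t₁)) - ξ) = 18 := by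
      rw [hξ_def, transfer_nb_centre hch hsy hx huS hbu hc1 hbuu']; exact zchart_sqNormInt_eq (hch x hx) hc1
    have Dθη : sqNormInt (zlab Pc nb u (nb x (c + t₁)) - zlab Pc nb u (nb x (-t₁))) = 54 := by
      rw [transfer_nb_nb hch hsy hx huS hbu hc1 hnt₁ hbuu' hbum]
      exact (dist_oddCap_ca (Pc x) hPx t₁ ht₁ t₂ ht₂ c hcP h12 hhex hcoff hc1 hc2).2.2.2.1
    have hθeq : zlab Pc nb u (nb x (c + t₁)) = t₁' := by
      have h := label_third_vertex (Pc u) hPu (ξ - t₁') hηP ξ hξP _ hθ.1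
        (by rw [show ξ - t₁' - ξ = -t₁' by abel, sqNormInt_neg]; exact Dt₁')
        Dθξ (by rw [← hη]; exact Dθη) (by rw [show ξ - (ξ - t₁') = t₁' by abel]; exact ht₁'P)
      rw [h]; abel
    rw [hatt]
    refine ⟨?_, hbuu', hθeq⟩
    rw [← hθeq]; exact hθ.2.symm

/-- **`V ∘ I = I ∘ V`, collinearity.**  With `u = (V g).pt` and `u' = (V (I g)).pt`, the label of
`u` at `u'` is `−(V (I g)).t₁`: in the model `u = (k+1, i, j)` is the `−t₁`-neighbour of
`u' = (k+1, i+1, j)`.  Hypotheses: the in-layer neighbourhoods of `g` and of `I g` are valid.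
[folklore] -/
theorem Vstep_Istep_back (hch : ∀ z ∈ S, IsZChart S z (Pc z) (Ac z) (nb z))
    (hsy : ∀ x ∈ S, ∀ y ∈ shell S x, x ∈ shell S y) {x : (EuclideanSpace ℝ (Fin 3))}
    (hx : x ∈ S) {t₁ t₂ : Fin 3 → ℤ} {U : Finset (Fin 3 → ℤ)} (hU : IsFrame (Pc x) t₁ t₂ U)
    (hI : IsFrame (Pc (nb x t₁)) (Istep Pc nb ⟨x, t₁, t₂, U⟩).t₁ (Istep Pc nb ⟨x, t₁, t₂, U⟩).t₂
      (Istep Pc nb ⟨x, t₁, t₂, U⟩).U)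
    (hJ : IsFrame (Pc (nb x t₂)) (Jstep Pc nb ⟨x, t₁, t₂, U⟩).t₁ (Jstep Pc nb ⟨x, t₁, t₂, U⟩).t₂
      (Jstep Pc nb ⟨x, t₁, t₂, U⟩).U)
    (hIi : IsFrame (Pc (nb x (-t₁))) (IinvStep Pc nb ⟨x, t₁, t₂, U⟩).t₁
      (IinvStep Pc nb ⟨x, t₁, t₂, U⟩).t₂ (IinvStep Pc nb ⟨x, t₁, t₂, U⟩).U)
    (hJi : IsFrame (Pc (nb x (-t₂))) (JinvStep Pc nb ⟨x, t₁, t₂, U⟩).t₁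
      (JinvStep Pc nb ⟨x, t₁, t₂, U⟩).t₂ (JinvStep Pc nb ⟨x, t₁, t₂, U⟩).U)
    (hII : IsFrame (Pc (nb (nb x t₁) (Istep Pc nb ⟨x, t₁, t₂, U⟩).t₁))
      (Istep Pc nb (Istep Pc nb ⟨x, t₁, t₂, U⟩)).t₁ (Istep Pc nb (Istep Pc nb ⟨x, t₁, t₂, U⟩)).t₂
      (Istep Pc nb (Istep Pc nb ⟨x, t₁, t₂, U⟩)).U)
    (hJI : IsFrame (Pc (nb (nb x t₁) (Istep Pc nb ⟨x, t₁, t₂, U⟩).t₂))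
      (Jstep Pc nb (Istep Pc nb ⟨x, t₁, t₂, U⟩)).t₁ (Jstep Pc nb (Istep Pc nb ⟨x, t₁, t₂, U⟩)).t₂
      (Jstep Pc nb (Istep Pc nb ⟨x, t₁, t₂, U⟩)).U)
    (hIiI : IsFrame (Pc (nb (nb x t₁) (-(Istep Pc nb ⟨x, t₁, t₂, U⟩).t₁)))
      (IinvStep Pc nb (Istep Pc nb ⟨x, t₁, t₂, U⟩)).t₁ (IinvStep Pc nb (Istep Pc nb ⟨x, t₁, t₂, U⟩)).t₂
      (IinvStep Pc nb (Istep Pc nb ⟨x, t₁, t₂, U⟩)).U)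
    (hJiI : IsFrame (Pc (nb (nb x t₁) (-(Istep Pc nb ⟨x, t₁, t₂, U⟩).t₂)))
      (JinvStep Pc nb (Istep Pc nb ⟨x, t₁, t₂, U⟩)).t₁ (JinvStep Pc nb (Istep Pc nb ⟨x, t₁, t₂, U⟩)).t₂
      (JinvStep Pc nb (Istep Pc nb ⟨x, t₁, t₂, U⟩)).U) :
    zlab Pc nb (Vstep Pc nb (Istep Pc nb ⟨x, t₁, t₂, U⟩)).pt (Vstep Pc nb ⟨x, t₁, t₂, U⟩).pt =
        -(Vstep Pc nb (Istep Pc nb ⟨x, t₁, t₂, U⟩)).t₁ ∧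
      nb (Vstep Pc nb (Istep Pc nb ⟨x, t₁, t₂, U⟩)).pt (-(Vstep Pc nb (Istep Pc nb ⟨x, t₁, t₂, U⟩)).t₁) =
        (Vstep Pc nb ⟨x, t₁, t₂, U⟩).pt := by
  have hregI := hregI_of_valid (Pc := Pc) (nb := nb) hI
  obtain ⟨hyS, hbxy, hwP, hwx, -, -, -, -, -, -, -, hframe, hparI, -⟩ := Istep_spec hch hsy hx hU hregI
  obtain ⟨hcU, huS, hbu, hξP, hξx, hframeV, -, hbr⟩ := Vstep_spec hch hsy hx hU hI hJ hIi hJi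
  obtain ⟨hpt, hbuu', hθ⟩ := Vstep_Istep_pt hch hsy hx hU hI hJ hIi hJi
  have hPx := pattern_cases hch hx
  have hPy := pattern_cases hch hyS
  obtain ⟨h12, hhex, hUP, -, -⟩ := id hU
  have ht₁ : t₁ ∈ Pc x := hhex (mem_hexLabels_iff.2 (Or.inl rfl))
  have ht₂ : t₂ ∈ Pc x := hhex (mem_hexLabels_iff.2 (Or.inr (Or.inl rfl)))
  -- canonical names: `c, u` at `x`
  set c := apexOf t₁ t₂ U with hc_def
  have hcP : c ∈ Pc x := hUP hcU
  have hVpt : (Vstep Pc nb ⟨x, t₁, t₂, U⟩).pt = nb x c := rfl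
  rw [hVpt] at *
  set u := nb x c with hu_def
  set t₁' := (Vstep Pc nb ⟨x, t₁, t₂, U⟩).t₁ with ht₁'_def
  -- the frame `I g = ⟨y, a', b', U'⟩`
  set a' := (Istep Pc nb ⟨x, t₁, t₂, U⟩).t₁ with ha'
  set b' := (Istep Pc nb ⟨x, t₁, t₂, U⟩).t₂ with hb'
  set U' := (Istep Pc nb ⟨x, t₁, t₂, U⟩).U with hU'
  have hIeq : Istep Pc nb ⟨x, t₁, t₂, U⟩ = ⟨nb x t₁, a', b', U'⟩ := rfl
  rw [hIeq] at hII hJI hIiI hJiI hpt hbuu' hθ ⊢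
  obtain ⟨hc'U, hu'S, hbu', hξ'P, hξ'x, hframeV', -, hbr'⟩ :=
    Vstep_spec hch hsy hyS hframe hII hJI hIiI hJiI
  obtain ⟨h12', hhex', hUP', -, -⟩ := id hframe
  have ha'P : a' ∈ Pc (nb x t₁) := hhex' (mem_hexLabels_iff.2 (Or.inl rfl))
  have hb'P : b' ∈ Pc (nb x t₁) := hhex' (mem_hexLabels_iff.2 (Or.inr (Or.inl rfl)))
  -- canonical names: `c', u'` at `y`
  set c' := apexOf a' b' U' with hc'_def
  have hc'P : c' ∈ Pc (nb x t₁) := hUP' hc'U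
  have hV'pt : (Vstep Pc nb ⟨nb x t₁, a', b', U'⟩).pt = nb (nb x t₁) c' := rfl
  rw [hV'pt] at *
  set u' := nb (nb x t₁) c' with hu'_def
  set t₁'' := (Vstep Pc nb ⟨nb x t₁, a', b', U'⟩).t₁ with ht₁''_def
  have hPu' := pattern_cases hch hu'S
  have ht₁''P : t₁'' ∈ Pc u' := hframeV'.2.1 (mem_hexLabels_iff.2 (Or.inl rfl))
  have hnt₁''P : -t₁'' ∈ Pc u' :=
    hframeV'.2.1 (mem_hexLabels_iff.2 (Or.inr (Or.inr (Or.inr (Or.inl rfl)))))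
  have Dt₁'' : sqNormInt t₁'' = 18 := zchart_sqNormInt_eq (hch u' hu'S) ht₁''P
  -- `u ~ u'` and the label `α` of `u` at `u'`
  have hα := zlab_spec hch hu'S huS (hsy _ huS _ hbuu')
  rcases hbr with ⟨hpar, hL, hnI, -, -⟩ | ⟨hpar, hL, hnI, -, -⟩
  · /- EVEN -/
    have hpar' : frameParity a' b' U' = 1 := hparI.trans hpar
    rcases hbr' with ⟨-, hL', hnI', -, -⟩ | ⟨hpar'', -, -, -, -⟩
    swap
    · rw [hpar'] at hpar''; norm_num at hpar''
    obtain ⟨hatt, -⟩ := attach_I_even hch hsy hx hU hpar hregI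
    obtain ⟨-, -, hc'off, hc1', hc2', hE'⟩ := even_form_of_parity hPy hframe hpar'
    have huy : nb (nb x t₁) (c' - a') = u := hatt
    have hη'P : zlab Pc nb u' (nb x t₁) + t₁'' ∈ Pc u' := by
      have : zlab Pc nb u' (nb x t₁) + t₁'' ∈ lowerCap (Pc u') t₁''
          (Vstep Pc nb ⟨nb x t₁, a', b', U'⟩).t₂ (Vstep Pc nb ⟨nb x t₁, a', b', U'⟩).U := by
        rw [hL']; simp
      exact (mem_lowerCap_iff.1 this).1
    have hbII : nb (nb x t₁) a' ∈ shell S u' := by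
      rw [← hnI']; exact (nb_mem hch hu'S hη'P).2
    have hη' : zlab Pc nb u' (nb (nb x t₁) a') = zlab Pc nb u' (nb x t₁) + t₁'' := by
      rw [← hnI']; exact zlab_nb hch hu'S hη'P
    have hbu'u : nb (nb x t₁) (c' - a') ∈ shell S u' := by
      rw [huy]; exact hsy _ huS _ hbuu'
    have Dαξ' : sqNormInt (zlab Pc nb u' u - zlab Pc nb u' (nb x t₁)) = 18 := by
      have h := transfer_nb_centre hch hsy hyS hu'S hbu' hc1' hbu'u
      rw [huy] at h
      rw [h]
      exact zchart_sqNormInt_eq (hch _ hyS) hc1'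
    have Dαη' : sqNormInt (zlab Pc nb u' u - zlab Pc nb u' (nb (nb x t₁) a')) = 54 := by
      have h := transfer_nb_nb hch hsy hyS hu'S hbu' hc1' ha'P hbu'u hbII
      rw [huy] at h
      rw [h]
      exact (dist_evenCap_ca (Pc (nb x t₁)) hPy a' ha'P b' hb'P c' hc'P h12' hhex' hc'off
        hc1' hc2').1
    have hαeq : zlab Pc nb u' u = -t₁'' := by
      have h := label_third_vertex (Pc u') hPu' (zlab Pc nb u' (nb x t₁) + t₁'') hη'P
        (zlab Pc nb u' (nb x t₁)) hξ'P _ hα.1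
        (by rw [show zlab Pc nb u' (nb x t₁) + t₁'' - zlab Pc nb u' (nb x t₁) = t₁'' by abel]
            exact Dt₁'')
        Dαξ' (by rw [← hη']; exact Dαη')
        (by rw [show zlab Pc nb u' (nb x t₁) - (zlab Pc nb u' (nb x t₁) + t₁'') = -t₁'' by abel]
            exact hnt₁''P)
      rw [h]; abel
    refine ⟨hαeq, ?_⟩
    rw [← hαeq]; exact hα.2
  · /- ODD -/
    have hpar' : frameParity a' b' U' = -1 := hparI.trans hpar
    rcases hbr' with ⟨hpar'', -, -, -, -⟩ | ⟨-, hL', hnI', -, -⟩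
    · rw [hpar'] at hpar''; norm_num at hpar''
    obtain ⟨hatt, -⟩ := attach_I_odd hch hsy hx hU hpar hregI
    obtain ⟨-, -, hcoff, hc1, hc2, hO⟩ := odd_form_of_parity hPx hU hpar
    have hu'x : nb x (c + t₁) = u' := hatt.symm
    have hyx : nb (nb x t₁) (-a') = x := by
      show nb (nb x t₁) (-(-zlab Pc nb (nb x t₁) x)) = x
      rw [neg_neg]; exact hwx
    have hη'P : zlab Pc nb u' (nb x t₁) - t₁'' ∈ Pc u' := by
      have : zlab Pc nb u' (nb x t₁) - t₁'' ∈ lowerCap (Pc u') t₁''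
          (Vstep Pc nb ⟨nb x t₁, a', b', U'⟩).t₂ (Vstep Pc nb ⟨nb x t₁, a', b', U'⟩).U := by
        rw [hL']; simp
      exact (mem_lowerCap_iff.1 this).1
    have hη' : zlab Pc nb u' x = zlab Pc nb u' (nb x t₁) - t₁'' := by
      have h : zlab Pc nb u' (nb (nb x t₁) (-a')) = zlab Pc nb u' (nb x t₁) - t₁'' := by
        rw [← hnI']; exact zlab_nb hch hu'S hη'P
      rwa [hyx] at h
    have hbxu' : u' ∈ shell S x := by
      rw [← hu'x]; exact (nb_mem hch hx hc1).2
    have hbu'u : nb x c ∈ shell S u' := hsy _ huS _ hbuu'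
    have hbu'y : nb x t₁ ∈ shell S u' := hsy _ hyS _ hbu'
    have Dαη' : sqNormInt (zlab Pc nb u' u - zlab Pc nb u' x) = 18 := by
      rw [hu_def, transfer_nb_centre hch hsy hx hu'S hbxu' hcP hbu'u]
      exact zchart_sqNormInt_eq (hch x hx) hcP
    have Dαξ' : sqNormInt (zlab Pc nb u' u - zlab Pc nb u' (nb x t₁)) = 54 := by
      rw [hu_def, transfer_nb_nb hch hsy hx hu'S hbxu' hcP ht₁ hbu'u hbu'y, sqNormInt_sub_comm]
      exact (dist_oddCap (Pc x) hPx t₁ ht₁ t₂ ht₂ c hcP h12 hhex hcoff hc1 hc2).2.2.1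
    have hαeq : zlab Pc nb u' u = -t₁'' := by
      have h := label_third_vertex (Pc u') hPu' (zlab Pc nb u' (nb x t₁)) hξ'P
        (zlab Pc nb u' (nb x t₁) - t₁'') hη'P _ hα.1
        (by rw [show zlab Pc nb u' (nb x t₁) - (zlab Pc nb u' (nb x t₁) - t₁'') = t₁'' by abel]
            exact Dt₁'')
        (by rw [← hη']; exact Dαη') Dαξ'
        (by rw [show zlab Pc nb u' (nb x t₁) - t₁'' - zlab Pc nb u' (nb x t₁) = -t₁'' by abel]
            exact hnt₁''P)
      rw [h]; abel
    refine ⟨hαeq, ?_⟩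
    rw [← hαeq]; exact hα.2

/-! ## Anchor -/

/-- Anchor (registered sub-goal of stmt-AtomisticToContinuum-12088, toward `develop_transport`):
for a valid frame whose four in-layer transports are valid, the apex site over `Ix` is the
`t₁`-neighbour of the frame `V g` at the apex site over `x` and a shell point of the latter
(explicit form of the first two conjuncts of `Vstep_Istep_pt`). [folklore] -/
theorem transportComm1_anchor : ∀ (S : Set (EuclideanSpace ℝ (Fin 3))) (Pc : EuclideanSpace ℝ (Fin 3) → Finset (Fin 3 → ℤ)) (Ac : EuclideanSpace ℝ (Fin 3) → (EuclideanSpace ℝ (Fin 3) →ₗᵢ[ℝ] EuclideanSpace ℝ (Fin 3))) (nb : EuclideanSpace ℝ (Fin 3) → (Fin 3 → ℤ) → EuclideanSpace ℝ (Fin 3)), (∀ z ∈ S, IsZChart S z (Pc z) (Ac z) (nb z)) → (∀ x ∈ S, ∀ y ∈ shell S x, x ∈ shell S y) → ∀ x ∈ S, ∀ (t₁ t₂ : Fin 3 → ℤ) (U : Finset (Fin 3 → ℤ)), IsFrame (Pc x) t₁ t₂ U → IsFrame (Pc (nb x t₁)) (Istep Pc nb ⟨x, t₁, t₂, U⟩).t₁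 (Istep Pc nb ⟨x, t₁, t₂, U⟩).t₂ (Istep Pc nb ⟨x, t₁, t₂, U⟩).U → IsFrame (Pc (nb x t₂)) (Jstep Pc nb ⟨x, t₁, t₂, U⟩).t₁ (Jstep Pc nb ⟨x, t₁, t₂, U⟩).t₂ (Jstep Pc nb ⟨x, t₁, t₂, U⟩).U → IsFrame (Pc (nb x (-t₁))) (IinvStep Pc nb ⟨x, t₁, t₂, U⟩).t₁ (IinvStep Pc nb ⟨x, t₁, t₂, U⟩).t₂ (IinvStep Pc nb ⟨x, t₁, t₂, U⟩).U → IsFrame (Pc (nb x (-t₂))) (JinvStep Pc nb ⟨x, t₁, t₂, U⟩).t₁ (JinvStep Pc nb ⟨x, t₁, t₂, U⟩).t₂ (JinvStep Pc nb ⟨x, t₁, t₂, U⟩).U → (Vstep Pc nb (Istep Pc nb ⟨x, t₁, t₂, U⟩)).pt = nb (Vstep Pc nb ⟨x, t₁, t₂, U⟩).pt (Vstep Pc nb ⟨x, t₁, t₂, U⟩).t₁ ∧ (Vstep Pc nb (Istep Pc nb ⟨x, t₁, t₂, U⟩)).pt ∈ shell S (Vstep Pc nb ⟨x, t₁, t₂,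 U⟩).pt :=
  fun _ _ _ _ hch hsy _ hx _ _ _ hU hI hJ hIi hJi =>
    ⟨(Vstep_Istep_pt hch hsy hx hU hI hJ hIi hJi).1, (Vstep_Istep_pt hch hsy hx hU hI hJ hIi hJi).2.1⟩

end Summit.AtomisticToContinuum.Crystallization.Theorems.HullExactificationCascadeRobustBarlowTemplate

end
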